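import Literature.Barriers.CriticalPhenomena.PlaquetteWalkHoleRootKillSignSchema
import HarnessLib

/-!
# Barrier catalogue (SAWScalingLimit): the WEST sign schemas with the CLOSED-CORRIDOR column clause, and the corner-kill
table's last row `57b (0,4)` as a closed theorem — all 44 predicted kills of the table are closed sign theorems

Leaf of `PlaquetteWalkHoleRootKillSignSchema`; the western twin of `PlaquetteWalkHoleRootCorridor`. The western kill
schemas (`K_S2 = (w.1 − 3, w.2 − 2)` kills the under route's `w₂`-free class, `K_N1 = (w.1 − 3, w.2 + 2)` the over route's
`w₁`-free class) carry a column clause on the western doors of the far cell's column `w.1 − 2` below (above) the kill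
row: two-way («no door», `PlaquetteWalkHoleRootStructuralKillQuadrant` §1) or three-way («… or a dead end behind it»,
§1 there and `PlaquetteWalkHoleRootLawLCertified`). Both are instances of ONE clause, typed here: there is a set `R` of
cells west of the far cell's column — a CLOSED CORRIDOR — whose only doors to the rest of the domain are its eastern
doors onto the far cell's column at rows below the kill row, and every usable western door of that column below the
kill row leads into `R` (`IsCorridorSW`; `R = ∅` is the two-way clause, `R = {dead end}` the three-way one,
`R = {(w.1 − 3, y), (w.1 − 3, y − 1)}` the two-cell corridor of the corner-kill table's frame `57b`). MECHANISM (the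
even–odd rule): a walk to the far cell starts and ends outside `R` (`not_mem_corridorSW_of_side_eq_farW_side`: the far
cell's western neighbour is no corridor cell, its door onto the far cell lying above the kill row), so its crossings of
`R`'s doors are EVEN in number on the excursion range (`even_card_changes_iff`); the quadrant parity count
(`ΩG.odd_card_eastEdgeSW_of_AJ_ne_zero`) makes the excursion's crossings of the west sides of the far cell's column below
the far cell ODD; the doors at unusable rows and at the kill row are not crossed; so the `W` side of the cell below the
far cell is crossed an odd number of times — at least once (★★★ `ΩG.exists_excursion_arc_farSW_W_of_AJ_ne_zero_corridor`),
and the chain of the quadrant leaf runs unchanged: `ΩG.kindsIn_farSW_eq_of_wound_under_corridor`,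
`ΩG.under_killed_of_killSW_corridor`, the row-mirror twins `ΩG.kindsIn_farNW_eq_of_wound_over_corridor` /
`ΩG.over_killed_of_killNW_corridor` (`IsCorridorNW`, `isCorridorSW_rowMirrorDom`), the sign schemas and the kill-forced
zero at the reference position (§5) and — translating `R` with the domain, `isCorridorSW_refShift` — at every position
(§6): ★ `im_vertexFunctional_printed_pi_div_three_pos_of_killSW_corridor`, `…_two_pi_div_three_neg_of_killNW_corridor`,
`vertexFunctional_printed_farCellW_exists_eq_zero_Ioo_of_west_kills_corridor`. §7: the corner-kill table's row
`57b (0,4)` (`5×7 ∖ {(2,2), (0,4)}`, corridor `{(0,5), (0,6)}`; no local column clause applies): `frame57b_KN1_sign`.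
With `PlaquetteWalkHoleRootLawLCertified`, `PlaquetteWalkHoleRootEastDeadEnd`, `PlaquetteWalkHoleRootLawLTable` and
`PlaquetteWalkHoleRootCorridor` (`frame57b_KN2_sign`), ALL 44 kills predicted and observed in the venture lane's
pre-registered corner-kill table (LAW L, `FINDING-YB-KILL-FORCED-ZEROS.md` §5) are closed sign theorems on their exact
domains.

Not in print; venture lane «pcv-sawmu», seat b-step0 gen 26.

References: A. Glazman, I. Manolescu, arXiv:1708.00395v3, §1, §2.1, §4.2 and Lemma 2.1 [GlazmanManolescu2019];
A. Glazman, Electron. Commun. Probab. 20 (2015) no. 86, Lemma 3.1 [Glazman2015WeightedSAW]; R. Courant, H. Robbins,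
*What is Mathematics?* (1941/1958), Ch. V Appendix §2 [CourantRobbins1958]; H. Duminil-Copin, S. Smirnov, Ann. of Math.
175 (2012), Lemma 1 [DuminilCopinSmirnov2012].
-/

noncomputable section

open Set Function Complex

namespace Literature.Probability.RandomPlanarGeometry.SAW.YangBaxter

open Real
open Literature.Barriers.CriticalPhenomena.PlaquetteWalk (mirrorRowFace mirrorRowFace_mirrorRowFace)

/-! ## §1 Closed western corridors -/

section Corridors

variable (w : Face)

/-- **A closed western corridor below the kill row** (southern form): a set `R` of cells west of the far cell's column
whose western, northern and southern neighbours inside the domain stay in `R`, and whose eastern neighbours inside the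
domain but outside `R` occur only for cells of column `w.1 − 3` at rows `≤ w.2 − 3` — the eastern doors of that column
onto the far cell's column below the kill row are the ONLY doors of `R`.
[cite: CourantRobbins1958, Ch. V Appendix §2 (the even–odd rule)] -/
def IsCorridorSW (D R : Set Face) : Prop :=
  ∀ c ∈ R, c.1 ≤ w.1 - 3 ∧ (((c.1 - 1, c.2) : Face) ∈ D → ((c.1 - 1, c.2) : Face) ∈ R) ∧
    (((c.1, c.2 + 1) : Face) ∈ D → ((c.1, c.2 + 1) : Face) ∈ R) ∧
    (((c.1, c.2 - 1) : Face) ∈ D → ((c.1, c.2 - 1) : Face) ∈ R) ∧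
    (((c.1 + 1, c.2) : Face) ∈ D → ((c.1 + 1, c.2) : Face) ∉ R → c.1 = w.1 - 3 ∧ c.2 ≤ w.2 - 3)

/-- **A closed western corridor above the kill row** (northern form, the row mirror).
[cite: CourantRobbins1958, Ch. V Appendix §2 (the even–odd rule)] -/
def IsCorridorNW (D R : Set Face) : Prop :=
  ∀ c ∈ R, c.1 ≤ w.1 - 3 ∧ (((c.1 - 1, c.2) : Face) ∈ D → ((c.1 - 1, c.2) : Face) ∈ R) ∧
    (((c.1, c.2 + 1) : Face) ∈ D → ((c.1, c.2 + 1) : Face) ∈ R) ∧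
    (((c.1, c.2 - 1) : Face) ∈ D → ((c.1, c.2 - 1) : Face) ∈ R) ∧
    (((c.1 + 1, c.2) : Face) ∈ D → ((c.1 + 1, c.2) : Face) ∉ R → c.1 = w.1 - 3 ∧ w.2 + 3 ≤ c.2)

variable {w}

/-- **The doors of a closed western corridor** are the west sides of the far cell's column below the kill row.
[cite: CourantRobbins1958, Ch. V Appendix §2 (the even–odd rule)] -/
theorem exists_eq_vert_of_corridorSW_door {D R : Set Face} (hR : IsCorridorSW w D R) {e : MidEdge}
    (hd : e.faces.1 ∈ D ∧ e.faces.2 ∈ D) (hx : ¬(e.faces.1 ∈ R ↔ e.faces.2 ∈ R)) :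
    ∃ y : ℤ, y ≤ w.2 - 3 ∧ e = MidEdge.vert (w.1 - 2) y := by
  cases e with
  | vert x y =>
    simp only [MidEdge.faces] at hd hx
    by_cases h1 : ((x - 1, y) : Face) ∈ R
    · have h2 : ((x, y) : Face) ∉ R := fun h2 => hx ⟨fun _ => h2, fun _ => h1⟩
      obtain ⟨-, -, -, -, hE⟩ := hR _ h1
      have e : ((x - 1 + 1, y) : Face) = (x, y) := Prod.ext (by show x - 1 + 1 = x; ring) rfl
      rw [e] at hE
      obtain ⟨ex, ey⟩ := hE hd.2 h2
      have ex' : x - 1 = w.1 - 3 := ex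
      exact ⟨y, ey, by rw [show w.1 - 2 = x by omega]⟩
    · have h2 : ((x, y) : Face) ∈ R := by
        by_contra h2; exact hx ⟨fun h => absurd h h1, fun h => absurd h h2⟩
      obtain ⟨-, hW, -, -, -⟩ := hR _ h2
      exact absurd (hW hd.1) h1
  | slant x y =>
    simp only [MidEdge.faces] at hd hx
    exfalso
    by_cases h2 : ((x, y) : Face) ∈ R
    · have h1 : ((x, y - 1) : Face) ∉ R := fun h1 => hx ⟨fun _ => h2, fun _ => h1⟩
      obtain ⟨-, -, -, hS, -⟩ := hR _ h2
      exact h1 (hS hd.1)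
    · have h1 : ((x, y - 1) : Face) ∈ R := by
        by_contra h1; exact hx ⟨fun h => absurd h h1, fun h => absurd h h2⟩
      obtain ⟨-, -, hN, -, -⟩ := hR _ h1
      have e : ((x, y - 1 + 1) : Face) = (x, y) := Prod.ext rfl (by show y - 1 + 1 = y; ring)
      rw [e] at hN
      exact h2 (hN hd.2)

/-- The reflection on a cell, in coordinates. [cite: GlazmanManolescu2019, §4.2 (lattice symmetries)] -/
private theorem mirrorRowFace_mkW (w : Face) (x y : ℤ) : mirrorRowFace w.2 ((x, y) : Face) = (x, 2 * w.2 - y) := by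
  simp [mirrorRowFace]

/-- The row mirror carries a northern western corridor to a southern one. [cite: GlazmanManolescu2019, §4.2 (lattice symmetries)] -/
theorem isCorridorSW_rowMirrorDom {D R : Set Face} (hR : IsCorridorNW w D R) :
    IsCorridorSW w (rowMirrorDom w D) (rowMirrorDom w R) := by
  intro c hc
  obtain ⟨x, y⟩ := c
  simp only [mem_rowMirrorDom, mirrorRowFace_mkW] at hc ⊢
  obtain ⟨hq, hW, hN, hS, hE⟩ := hR _ hc
  simp only at hq hW hN hS hE
  refine ⟨hq, hW, ?_, ?_, ?_⟩
  · intro h; rw [show 2 * w.2 - (y + 1) = 2 * w.2 - y - 1 by ring] at h ⊢; exact hS h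
  · intro h; rw [show 2 * w.2 - (y - 1) = 2 * w.2 - y + 1 by ring] at h ⊢; exact hN h
  · intro h h'; obtain ⟨ex, ey⟩ := hE h h'; exact ⟨ex, by omega⟩

/-- A cell west of the far cell's column with a side on a side of the far cell is the far cell's western neighbour
(coordinate form). [cite: GlazmanManolescu2019, §1 (the lattice of rhombi and its mid-edges)] -/
private theorem eq_of_side_eq_farW_side_of_fst_le {w c : Face} {s t : Side} (h : c.side s = (farW w).side t)
    (hc : c.1 ≤ w.1 - 3) : c = (w.1 - 3, w.2) := by
  obtain ⟨a, b⟩ := w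
  obtain ⟨p, q⟩ := c
  cases s <;> cases t <;>
    simp only [farW, Face.side, MidEdge.vert.injEq, MidEdge.slant.injEq, reduceCtorEq, Prod.mk.injEq] at h hc ⊢ <;>
    omega

/-- **The excursion starts and ends outside every western corridor**: no cell sharing a side with the far cell is a
corridor cell — such a cell lies in the far cell's column or east of it, except the far cell's western neighbour,
whose eastern door onto the far cell would be a door of the corridor ABOVE the kill row.
[cite: CourantRobbins1958, Ch. V Appendix §2 (the even–odd rule)] -/
theorem not_mem_corridorSW_of_side_eq_farW_side {D R : Set Face} (hR : IsCorridorSW w D R) (hf : farW w ∈ D)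
    {c : Face} {s t : Side} (h : c.side s = (farW w).side t) : c ∉ R := by
  intro hc
  obtain ⟨hq, -, -, -, hE⟩ := hR _ hc
  have e := eq_of_side_eq_farW_side_of_fst_le h hq
  subst e
  simp only at hE
  have hfR : farW w ∉ R := fun h' => by have := (hR _ h').1; simp only [farW] at this; omega
  have e1 : ((w.1 - 3 + 1, w.2) : Face) = farW w := Prod.ext (by show w.1 - 3 + 1 = w.1 - 2; ring) rfl
  rw [e1] at hE
  have := (hE hf hfR).2
  omega

end Corridors

namespace ΩG

variable {D : Set Face} {w : Face}

/-! ## §2 The west crossing below the far cell, corridor form -/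

/-- ★★★ **THE POCKET LEMMA, CLOSED-CORRIDOR FORM.** Hole and `K_S2` absent; a closed western corridor `R` below the kill
row; every western door of the far cell's column at a row `≤ w.2 − 3` absent or leading into `R`. Then the excursion of
a class-`B2a` under-walk at the far cell whose excursion winds around the root has an arc in the cell below the far
cell through its `W` side: the excursion's crossings of `R`'s doors are even (it starts and ends outside `R`), its
crossings of the west sides of the far cell's column below the far cell are odd (the quadrant parity count), the kill
row's door is shut — so the crossings at row `w.2 − 1` are odd.
[cite: CourantRobbins1958, Ch. V Appendix §2 (the even–odd rule)] [cite: Glazman2015WeightedSAW, Lemma 3.1 (proof, pp. 6–7)] -/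
theorem exists_excursion_arc_farSW_W_of_AJ_ne_zero_corridor (hh : holeFaceW w ∉ D) (hK : killSW w ∉ D)
    {R : Set Face} (hR : IsCorridorSW w D R)
    (hcol : ∀ y : ℤ, y ≤ w.2 - 3 → (w.1 - 3, y) ∉ D ∨ (w.1 - 2, y) ∉ D ∨ ((w.1 - 3, y) : Face) ∈ R)
    (ω : ΩG D (w.side .W) (farW w)) (hr : RootedFace D (w.side .W) (farW w)) (h : ω.IsB2a)
    (hS : ω.2.firstSideG = .S) (hA : ω.AJ hr h (toC (midPt (w.side .W))) ≠ 0) :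
    ∃ k, ω.2.firstHitG < k ∧ k < ω.2.arcs.length ∧ ω.2.fc k = farSW w ∧ (ω.2.sIn k = .W ∨ ω.2.sOut k = .W) := by
  classical
  have hodd := ω.odd_card_eastEdgeSW_of_AJ_ne_zero hh hr h hS hA
  have hF := ω.fh_lt h
  have hB2 : ω.2.firstHitG + 1 < ω.2.arcs.length := h.1
  set F := ω.2.firstHitG with hFdef
  set n := ω.2.arcs.length with hndef
  set K := Finset.Ioc (F + 1) (n - 1) with hKdef
  set E := K.filter fun k => IsEastEdgeSW w (ω.2.nth k) with hEdef
  have hgW : (farSW w).side .W = MidEdge.vert (w.1 - 2) (w.2 - 1) := by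
    obtain ⟨a, c⟩ := w; simp [farSW, Face.side]
  -- membership in the corridor along the walk
  let bR : ℕ → Bool := fun k => decide (ω.2.fc k ∈ R)
  have hxR : ∀ {c : Face} {s t : Side}, c.side s = (farW w).side t → c ∉ R :=
    fun hc => not_mem_corridorSW_of_side_eq_farW_side hR hr.mem hc
  have hbF : bR (F + 1) = false := by
    have hin := (ω.2.side_sIn_nth (i := F + 1) hB2).1
    rw [(ω.2.exitSide_specG hr hF).1] at hin
    simp only [bR, decide_eq_false_iff_not]
    exact hxR hin
  have hbL : bR (n - 1) = false := by
    have hout := (ω.2.side_sIn_nth (i := n - 1) (by omega)).2.1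
    rw [show n - 1 + 1 = n by omega, ω.2.nth_length] at hout
    simp only [bR, decide_eq_false_iff_not]
    exact hxR hout
  have hevenR := (even_card_changes_iff bR (F + 1) (n - 1) (by omega)).2 (hbF.trans hbL.symm)
  -- the two faces of the `k`-th edge are the cells of arcs `k - 1`, `k`
  have hfaces : ∀ k ∈ K, ((ω.2.nth k).faces.1 ∈ D ∧ (ω.2.nth k).faces.2 ∈ D) ∧
      ((ω.2.fc (k - 1) = (ω.2.nth k).faces.1 ∧ ω.2.fc k = (ω.2.nth k).faces.2) ∨
        (ω.2.fc (k - 1) = (ω.2.nth k).faces.2 ∧ ω.2.fc k = (ω.2.nth k).faces.1)) := by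
    intro k hk
    rw [hKdef, Finset.mem_Ioc] at hk
    have hout := (ω.2.side_sIn_nth (i := k - 1) (by omega)).2.1
    have hin := (ω.2.side_sIn_nth (i := k) (by omega)).1
    rw [show k - 1 + 1 = k by omega] at hout
    have hne : ω.2.fc (k - 1) ≠ ω.2.fc (k - 1 + 1) := YBWalk.fc_succ_ne (by omega)
    rw [show k - 1 + 1 = k by omega] at hne
    refine ⟨ω.2.door_nth (j := k) (by omega) (by omega), ?_⟩
    rcases (Face.exists_side_eq_iff _ _).1 ⟨_, hout⟩ with e1 | e1 <;>
      rcases (Face.exists_side_eq_iff _ _).1 ⟨_, hin⟩ with e2 | e2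
    · exact absurd (e1.trans e2.symm) hne
    · exact Or.inl ⟨e1, e2⟩
    · exact Or.inr ⟨e1, e2⟩
    · exact absurd (e1.trans e2.symm) hne
  -- a corridor-door crossing is a crossing of a west side of the far cell's column at a row `≤ w.2 - 3`
  have hflip : ∀ k ∈ K, bR (k - 1) ≠ bR k → ∃ y : ℤ, y ≤ w.2 - 3 ∧ ω.2.nth k = MidEdge.vert (w.1 - 2) y := by
    intro k hk hb
    obtain ⟨hd, hf⟩ := hfaces k hk
    refine exists_eq_vert_of_corridorSW_door hR hd ?_
    simp only [bR, ne_eq, decide_eq_decide] at hb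
    rcases hf with ⟨e1, e2⟩ | ⟨e1, e2⟩
    · rw [← e1, ← e2]; exact hb
    · rw [← e1, ← e2]; exact fun hh => hb hh.symm
  -- an east-edge crossing of the quadrant that is not a corridor-door crossing is at row `w.2 - 1`
  have hrest : ∀ k ∈ E, ¬(bR (k - 1) ≠ bR k) → ω.2.nth k = (farSW w).side .W := by
    intro k hk hb
    rw [hEdef, Finset.mem_filter] at hk
    obtain ⟨hkK, heast⟩ := hk
    obtain ⟨hd, hf⟩ := hfaces k hkK
    push Not at hb
    cases hnth : ω.2.nth k with
    | slant x y => rw [hnth] at heast; exact absurd heast (by simp [IsEastEdgeSW])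
    | vert x y =>
      rw [hnth] at heast hd hf
      simp only [IsEastEdgeSW] at heast
      obtain ⟨hx, hy⟩ := heast
      subst hx
      simp only [MidEdge.faces] at hd hf
      have e3 : ((w.1 - 2 - 1, y) : Face) = (w.1 - 3, y) := Prod.ext (by show w.1 - 2 - 1 = w.1 - 3; ring) rfl
      rw [e3] at hd hf
      have hy1 : y = w.2 - 1 := by
        rcases lt_or_eq_of_le hy with hlt | heq
        · exfalso
          rcases lt_or_eq_of_le (show y ≤ w.2 - 2 by omega) with hlt2 | heq2
          · rcases hcol y (by omega) with hc | hc | hcR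
            · exact hc hd.1
            · exact hc hd.2
            · -- the door leads into the corridor: the crossing IS a corridor-door crossing
              have hE' : ((w.1 - 2, y) : Face) ∉ R := fun h' => by have := (hR _ h').1; simp only at this; omega
              simp only [bR, decide_eq_decide] at hb
              rcases hf with ⟨e1, e2⟩ | ⟨e1, e2⟩
              · rw [e1, e2] at hb; exact hE' (hb.1 hcR)
              · rw [e1, e2] at hb; exact hE' (hb.2 hcR)
          · apply hK
            have e : killSW w = (w.1 - 3, y) := by rw [heq2]; rfl
            rw [e]; exact hd.1
        · exact heq
      rw [hy1, hgW]
  -- counting: the corridor-door crossings in `K` are exactly the flips of `bR`, all in `E`; they are even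
  have hsub : (K.filter fun k => bR (k - 1) ≠ bR k) = E.filter fun k => bR (k - 1) ≠ bR k := by
    ext k
    simp only [hEdef, Finset.mem_filter]
    constructor
    · rintro ⟨hk, hb⟩
      obtain ⟨y, hy, e⟩ := hflip k hk hb
      exact ⟨⟨hk, by rw [e]; exact ⟨rfl, by omega⟩⟩, hb⟩
    · rintro ⟨⟨hk, -⟩, hb⟩; exact ⟨hk, hb⟩
  rw [hsub] at hevenR
  have hcard := Finset.card_filter_add_card_filter_not (s := E) (fun k => bR (k - 1) ≠ bR k)
  have hodd' : Odd (E.filter fun k => ¬(bR (k - 1) ≠ bR k)).card := by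
    rcases Nat.even_or_odd (E.filter fun k => ¬(bR (k - 1) ≠ bR k)).card with he | he
    · exfalso
      rw [← hcard] at hodd
      exact Nat.not_even_iff_odd.2 hodd (hevenR.add he)
    · exact he
  obtain ⟨k, hk⟩ := Finset.card_pos.1 hodd'.pos
  rw [Finset.mem_filter] at hk
  have hnth := hrest k hk.1 hk.2
  have hkK : k ∈ K := (Finset.mem_filter.1 hk.1).1
  rw [hKdef, Finset.mem_Ioc] at hkK
  obtain ⟨hk1, hk2⟩ := hkK
  -- arcs `k - 1` and `k` lie in the pocket and in the cell below the far cell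
  have hout := (ω.2.side_sIn_nth (i := k - 1) (by omega)).2.1
  have hin := (ω.2.side_sIn_nth (i := k) (by omega)).1
  rw [show k - 1 + 1 = k by omega, hnth] at hout
  rw [hnth] at hin
  have hf1 := (Face.exists_side_eq_iff _ _).1 ⟨_, hout⟩
  have hf2 := (Face.exists_side_eq_iff _ _).1 ⟨_, hin⟩
  rw [← pocketSW_side_E, pocketSW_side_E_faces] at hf1 hf2
  simp only at hf1 hf2
  have hne : ω.2.fc (k - 1) ≠ ω.2.fc (k - 1 + 1) := YBWalk.fc_succ_ne (by omega)
  rw [show k - 1 + 1 = k by omega] at hne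
  rcases hf2 with e2 | e2
  · have e1 : ω.2.fc (k - 1) = farSW w := by
      rcases hf1 with e | e
      · exact absurd (e.trans e2.symm) hne
      · exact e
    exact ⟨k - 1, by omega, by omega, e1, Or.inr (Face.side_injective (farSW w) (by rw [e1] at hout; exact hout))⟩
  · exact ⟨k, by omega, by omega, e2, Or.inl (Face.side_injective (farSW w) (by rw [e2] at hin; exact hin))⟩

/-! ## §3 The `K_S2` kill, corridor form -/

/-- ★★★ **THE STRUCTURAL UNDER-ROUTE `w₂`-KILL, CLOSED-CORRIDOR FORM**: hole, kill cell `K_S2 = (w.1 − 3, w.2 − 2)`, a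
closed western corridor taking every usable western door of the far cell's column below the kill row ⇒ every wound
class-`B2a` under-walk at the far cell carries `kindsIn (farSW w) = [coCorner, coCorner]`.
[cite: GlazmanManolescu2019, §1, Fig. 1 and the paragraph of Fig. 2 («if θ = π/3, then w₂ = 0»)]
[cite: Glazman2015WeightedSAW, Lemma 3.1 (proof, pp. 6–7)] [cite: CourantRobbins1958, Ch. V Appendix §2 (the even–odd rule)] -/
theorem kindsIn_farSW_eq_of_wound_under_corridor (hh : holeFaceW w ∉ D) (hK : killSW w ∉ D)
    {R : Set Face} (hR : IsCorridorSW w D R)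
    (hcol : ∀ y : ℤ, y ≤ w.2 - 3 → (w.1 - 3, y) ∉ D ∨ (w.1 - 2, y) ∉ D ∨ ((w.1 - 3, y) : Face) ∈ R)
    (ω : ΩG D (w.side .W) (farW w)) (hr : RootedFace D (w.side .W) (farW w)) (h : ω.IsB2a)
    (hS : ω.2.firstSideG = .S) {θ : ℝ}
    (hW : ω.WE (fun _ => θ) ≠ excursionWinding θ ω.2.firstSideG (ω.z1 hr h) ω.1) :
    ω.2.kindsIn (farSW w) = [.coCorner, .coCorner] := by
  rcases ω.AJ_ne_zero_or_rev_of_wound hr h θ hW with hA | hA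
  · obtain ⟨k, hFk, hkn, hfck, hkW⟩ := ω.exists_excursion_arc_farSW_W_of_AJ_ne_zero_corridor hh hK hR hcol hr h hS hA
    exact ω.kindsIn_farSW_eq_of_excursion_arc_W h hS hFk hkn hfck hkW
  · have h' := ω.rev_isB2a hr h
    have hS' : (ω.rev hr).2.firstSideG = .S := (ω.rev_firstSide hr h).trans hS
    obtain ⟨k, hFk, hkn, hfck, hkW⟩ :=
      (ω.rev hr).exists_excursion_arc_farSW_W_of_AJ_ne_zero_corridor hh hK hR hcol hr h' hS' hA
    have hk := (ω.rev hr).kindsIn_farSW_eq_of_excursion_arc_W h' hS' hFk hkn hfck hkW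
    have hperm := ω.kindsIn_rev_perm hr h (farSW_ne_farW w)
    rw [hk] at hperm
    have hp : (ω.2.kindsIn (farSW w)).Perm (List.replicate 2 .coCorner) := hperm.symm
    exact List.perm_replicate.1 hp

/-- ★★★ «Every wound under-walk is `w₂`-marked off the far cell», closed-corridor form (the companion file's
hypothesis `hS₂`). [cite: GlazmanManolescu2019, §1 (the paragraph of Fig. 2)] [cite: CourantRobbins1958, Ch. V Appendix §2 (the even–odd rule)] -/
theorem under_killed_of_killSW_corridor (hh : holeFaceW w ∉ D) (hK : killSW w ∉ D)
    {R : Set Face} (hR : IsCorridorSW w D R)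
    (hcol : ∀ y : ℤ, y ≤ w.2 - 3 → (w.1 - 3, y) ∉ D ∨ (w.1 - 2, y) ∉ D ∨ ((w.1 - 3, y) : Face) ∈ R)
    (hr : RootedFace D (w.side .W) (farW w)) (θ : ℝ) :
    ∀ (ω : ΩG D (w.side .W) (farW w)) (h : ω.IsB2a), ω.2.firstSideG = .S →
      ω.WE (fun _ => θ) ≠ excursionWinding θ ω.2.firstSideG (ω.z1 hr h) ω.1 → ¬ω.2.W2FreeOff (farW w) :=
  fun ω h hS hW => ω.not_W2FreeOff_farW_of_kindsIn_farSW
    (ω.kindsIn_farSW_eq_of_wound_under_corridor hh hK hR hcol hr h hS hW)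

/-! ## §4 The `K_N1` kill, corridor form (row mirror) -/

/-- ★★★ **THE STRUCTURAL OVER-ROUTE `w₁`-KILL, CLOSED-CORRIDOR FORM** (row-mirror twin): hole, `K_N1 = (w.1 − 3, w.2 + 2)`,
a closed western corridor above the kill row taking every usable western door of the far cell's column above the kill
row ⇒ every wound over-walk has `kindsIn (farNW w) = [corner, corner]`.
[cite: GlazmanManolescu2019, §1, Fig. 1 and the remark after eq. (1)] [cite: Glazman2015WeightedSAW, Lemma 3.1 (proof, pp. 6–7)]
[cite: CourantRobbins1958, Ch. V Appendix §2 (the even–odd rule)] -/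
theorem kindsIn_farNW_eq_of_wound_over_corridor (hh : holeFaceW w ∉ D) (hK : killNW w ∉ D)
    {R : Set Face} (hR : IsCorridorNW w D R)
    (hcol : ∀ y : ℤ, w.2 + 3 ≤ y → (w.1 - 3, y) ∉ D ∨ (w.1 - 2, y) ∉ D ∨ ((w.1 - 3, y) : Face) ∈ R)
    (ω : ΩG D (w.side .W) (farW w)) (hr : RootedFace D (w.side .W) (farW w)) (h : ω.IsB2a)
    (hN : ω.2.firstSideG = .N) {θ : ℝ}
    (hW : ω.WE (fun _ => θ) ≠ excursionWinding θ ω.2.firstSideG (ω.z1 hr h) ω.1) :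
    ω.2.kindsIn (farNW w) = [.corner, .corner] := by
  have hr' := rootedFace_rowMirrorDom w hr
  have h' := ω.mirrorFar_isB2a hr h
  have hh' : holeFaceW w ∉ rowMirrorDom w D := by rwa [mem_rowMirrorDom, mirrorRowFace_holeFaceW]
  have hK' : killSW w ∉ rowMirrorDom w D := by rwa [mem_rowMirrorDom, mirrorRowFace_killSW]
  have hR' := isCorridorSW_rowMirrorDom hR
  have hcol' : ∀ y : ℤ, y ≤ w.2 - 3 → (w.1 - 3, y) ∉ rowMirrorDom w D ∨ (w.1 - 2, y) ∉ rowMirrorDom w D ∨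
      ((w.1 - 3, y) : Face) ∈ rowMirrorDom w R := by
    intro y hy
    simp only [mem_rowMirrorDom, mirrorRowFace_mkW]
    exact hcol (2 * w.2 - y) (by omega)
  have hS' : ω.mirrorFar.2.firstSideG = .S := by rw [mirrorFar_firstSideG, hN]; rfl
  have hk := ω.mirrorFar.kindsIn_farSW_eq_of_wound_under_corridor hh' hK' hR' hcol' hr' h' hS'
    (ω.mirrorFar_wound hr h hW)
  have hk2 := ω.kindsIn_eq_corner_of_mirrorFar_coCorner hk
  rwa [mirrorRowFace_farSW] at hk2

/-- ★★★ «Every wound over-walk is `w₁`-marked off the far cell», closed-corridor form (the companion file's hypothesis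
`hN₁`). [cite: GlazmanManolescu2019, §1, remark after eq. (1)] [cite: CourantRobbins1958, Ch. V Appendix §2 (the even–odd rule)] -/
theorem over_killed_of_killNW_corridor (hh : holeFaceW w ∉ D) (hK : killNW w ∉ D)
    {R : Set Face} (hR : IsCorridorNW w D R)
    (hcol : ∀ y : ℤ, w.2 + 3 ≤ y → (w.1 - 3, y) ∉ D ∨ (w.1 - 2, y) ∉ D ∨ ((w.1 - 3, y) : Face) ∈ R)
    (hr : RootedFace D (w.side .W) (farW w)) (θ : ℝ) :
    ∀ (ω : ΩG D (w.side .W) (farW w)) (h : ω.IsB2a), ω.2.firstSideG = .N →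
      ω.WE (fun _ => θ) ≠ excursionWinding θ ω.2.firstSideG (ω.z1 hr h) ω.1 → ¬ω.2.W1FreeOff (farW w) := by
  intro ω h hN hW hfree
  have hk := ω.kindsIn_farNW_eq_of_wound_over_corridor hh hK hR hcol hr h hN hW
  have hmem : farNW w ∈ ω.2.facesVisited := by
    by_contra hn
    rw [YBWalk.kindsIn_eq_nil hn] at hk
    exact List.cons_ne_nil _ _ hk.symm
  exact hfree _ hmem (farNW_ne_farW w) hk

end ΩG

end Literature.Probability.RandomPlanarGeometry.SAW.YangBaxter

namespace Literature.Barriers.CriticalPhenomena.PlaquetteWalk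

open Literature.Probability.RandomPlanarGeometry.SAW.YangBaxter
open Real Complex

/-! ## §5 The western sign schemas and the kill-forced zero, corridor form — reference position -/

section At42

variable {Dl : List Face}

/-- ★★★★ **`K_S2` ALONE ⇒ `Im VF(π/3) > 0`**, reference position, corridor form: west block, hole and `K_S2 = (1,0)`
absent, a closed western corridor `R` below the kill row taking every usable western door of column `2` below row `0`.
[cite: GlazmanManolescu2019, Lemma 2.1 (statement, "in the form given in [Gl]")] [cite: GlazmanManolescu2019, §1 (the paragraph of Fig. 2)] -/
theorem im_pos_pi_div_three_of_killSW_block42_corridor (hB : ∀ c ∈ westBlock42, c ∈ Dl)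
    (hh : holeFaceW w42 ∉ dom Dl) (hKS : killSW w42 ∉ dom Dl) {R : Set Face} (hR : IsCorridorSW w42 (dom Dl) R)
    (hcolS : ∀ y : ℤ, y ≤ w42.2 - 3 → (w42.1 - 3, y) ∉ dom Dl ∨ (w42.1 - 2, y) ∉ dom Dl ∨ ((w42.1 - 3, y) : Face) ∈ R) :
    0 < (vertexFunctional (printedWeights (π / 3)) tFiveEighths (ybCoeff (π / 3)) Dl (w42.side .W) (farW w42)).im := by
  have hf : farW w42 ∈ Dl := hB _ (by decide)
  have hr := rootedFace_of_farW_mem_of_hole hf hh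
  exact im_vertexFunctional_printed_farCellW_pi_div_three_pos_of_under_killed Dl w42 hf hh hr
    (ΩG.under_killed_of_killSW_corridor hh hKS hR hcolS hr _) (exists_over_witness_of_westBlock42 hB hr _)

/-- ★★★★ **`K_N1` ALONE ⇒ `Im VF(2π/3) < 0`**, reference position, corridor form.
[cite: GlazmanManolescu2019, Lemma 2.1 (statement, "in the form given in [Gl]")] [cite: GlazmanManolescu2019, §1, remark after eq. (1)] -/
theorem im_neg_two_pi_div_three_of_killNW_block42_corridor (hB : ∀ c ∈ westBlock42, c ∈ Dl)
    (hh : holeFaceW w42 ∉ dom Dl) (hKN : killNW w42 ∉ dom Dl) {R : Set Face} (hR : IsCorridorNW w42 (dom Dl) R)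
    (hcolN : ∀ y : ℤ, w42.2 + 3 ≤ y → (w42.1 - 3, y) ∉ dom Dl ∨ (w42.1 - 2, y) ∉ dom Dl ∨ ((w42.1 - 3, y) : Face) ∈ R) :
    (vertexFunctional (printedWeights (2 * π / 3)) tFiveEighths (ybCoeff (2 * π / 3)) Dl (w42.side .W)
      (farW w42)).im < 0 := by
  have hf : farW w42 ∈ Dl := hB _ (by decide)
  have hr := rootedFace_of_farW_mem_of_hole hf hh
  exact im_vertexFunctional_printed_farCellW_two_pi_div_three_neg_of_over_killed Dl w42 hf hh hr
    (ΩG.over_killed_of_killNW_corridor hh hKN hR hcolN hr _) (exists_under_witness_of_westBlock42 hB hr _)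

/-- ★★★★ **THE WESTERN KILL-FORCED ZERO, corridor form, reference position**: west block, hole, `K_S2` and `K_N1`
absent, a closed corridor below and one above the kill rows taking the usable western doors of column `2` ⇒ an exact
zero of the Yang–Baxter vertex functional at the far cell in `(π/3, 2π/3)`.
[cite: GlazmanManolescu2019, Lemma 2.1 (statement, "in the form given in [Gl]")]
[cite: GlazmanManolescu2019, §1 (the paragraph of Fig. 2 and the remark after eq. (1))]
[cite: DuminilCopinSmirnov2012, proof of Lemma 1] [cite: CourantRobbins1958, Ch. V Appendix §2 (the even–odd rule)] -/
theorem exists_eq_zero_of_west_kills_block42_corridor (Dl : List Face) (hB : ∀ c ∈ westBlock42, c ∈ Dl)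
    (hh : holeFaceW w42 ∉ dom Dl) (hKS : killSW w42 ∉ dom Dl) (hKN : killNW w42 ∉ dom Dl) {RS RN : Set Face}
    (hRS : IsCorridorSW w42 (dom Dl) RS) (hRN : IsCorridorNW w42 (dom Dl) RN)
    (hcolS : ∀ y : ℤ, y ≤ w42.2 - 3 → (w42.1 - 3, y) ∉ dom Dl ∨ (w42.1 - 2, y) ∉ dom Dl ∨ ((w42.1 - 3, y) : Face) ∈ RS)
    (hcolN : ∀ y : ℤ, w42.2 + 3 ≤ y → (w42.1 - 3, y) ∉ dom Dl ∨ (w42.1 - 2, y) ∉ dom Dl ∨ ((w42.1 - 3, y) : Face) ∈ RN) :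
    ∃ θ ∈ Set.Ioo (π / 3) (2 * π / 3),
      vertexFunctional (printedWeights θ) tFiveEighths (ybCoeff θ) Dl (w42.side .W) (farW w42) = 0 := by
  have hf : farW w42 ∈ Dl := hB _ (by decide)
  have hr := rootedFace_of_farW_mem_of_hole hf hh
  exact vertexFunctional_printed_farCellW_exists_eq_zero_Ioo_of_opposite_kills Dl w42 hf hh hr
    (ΩG.under_killed_of_killSW_corridor hh hKS hRS hcolS hr (π / 3)) (exists_over_witness_of_westBlock42 hB hr _)
    (ΩG.over_killed_of_killNW_corridor hh hKN hRN hcolN hr (2 * π / 3)) (exists_under_witness_of_westBlock42 hB hr _)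

end At42

/-! ## §6 Every position -/

section Translate

variable {Dl : List Face} {w : Face}

/-- Transport of a southern western corridor to the reference position (the corridor travels with the domain).
[cite: GlazmanManolescu2019, §4.2 (translation invariance)] -/
theorem isCorridorSW_refShift {R : Set Face} (hR : IsCorridorSW w (dom Dl) R) :
    IsCorridorSW w42 (dom (Dl.map (Face.shiftBy (-refShift w)))) {c | Face.shiftBy (refShift w) c ∈ R} := by
  intro c hc
  obtain ⟨x, y⟩ := c
  simp only [Set.mem_setOf_eq, shiftBy_refShift_mk] at hc
  obtain ⟨hq, hW, hN, hS, hE⟩ := hR _ hc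
  simp only at hq hW hN hS hE
  simp only [Set.mem_setOf_eq, mem_dom_map_shiftBy_neg, shiftBy_refShift_mk, w42]
  have e1 : ((x + 1 + (w.1 - 4), y + (w.2 - 2)) : Face) = (x + (w.1 - 4) + 1, y + (w.2 - 2)) :=
    Prod.ext (by show x + 1 + (w.1 - 4) = x + (w.1 - 4) + 1; ring) rfl
  have e2 : ((x + (w.1 - 4), y + 1 + (w.2 - 2)) : Face) = (x + (w.1 - 4), y + (w.2 - 2) + 1) :=
    Prod.ext rfl (by show y + 1 + (w.2 - 2) = y + (w.2 - 2) + 1; ring)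
  have e3 : ((x + (w.1 - 4), y - 1 + (w.2 - 2)) : Face) = (x + (w.1 - 4), y + (w.2 - 2) - 1) :=
    Prod.ext rfl (by show y - 1 + (w.2 - 2) = y + (w.2 - 2) - 1; ring)
  have e4 : ((x - 1 + (w.1 - 4), y + (w.2 - 2)) : Face) = (x + (w.1 - 4) - 1, y + (w.2 - 2)) :=
    Prod.ext (by show x - 1 + (w.1 - 4) = x + (w.1 - 4) - 1; ring) rfl
  refine ⟨by omega, fun h => ?_, fun h => ?_, fun h => ?_, fun h h' => ?_⟩
  · rw [e4] at h ⊢; exact hW h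
  · rw [e2] at h ⊢; exact hN h
  · rw [e3] at h ⊢; exact hS h
  · rw [e1] at h h'
    obtain ⟨ex, ey⟩ := hE h h'
    constructor <;> omega

/-- Transport of a northern western corridor to the reference position. [cite: GlazmanManolescu2019, §4.2 (translation invariance)] -/
theorem isCorridorNW_refShift {R : Set Face} (hR : IsCorridorNW w (dom Dl) R) :
    IsCorridorNW w42 (dom (Dl.map (Face.shiftBy (-refShift w)))) {c | Face.shiftBy (refShift w) c ∈ R} := by
  intro c hc
  obtain ⟨x, y⟩ := c
  simp only [Set.mem_setOf_eq, shiftBy_refShift_mk] at hc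
  obtain ⟨hq, hW, hN, hS, hE⟩ := hR _ hc
  simp only at hq hW hN hS hE
  simp only [Set.mem_setOf_eq, mem_dom_map_shiftBy_neg, shiftBy_refShift_mk, w42]
  have e1 : ((x + 1 + (w.1 - 4), y + (w.2 - 2)) : Face) = (x + (w.1 - 4) + 1, y + (w.2 - 2)) :=
    Prod.ext (by show x + 1 + (w.1 - 4) = x + (w.1 - 4) + 1; ring) rfl
  have e2 : ((x + (w.1 - 4), y + 1 + (w.2 - 2)) : Face) = (x + (w.1 - 4), y + (w.2 - 2) + 1) :=
    Prod.ext rfl (by show y + 1 + (w.2 - 2) = y + (w.2 - 2) + 1; ring)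
  have e3 : ((x + (w.1 - 4), y - 1 + (w.2 - 2)) : Face) = (x + (w.1 - 4), y + (w.2 - 2) - 1) :=
    Prod.ext rfl (by show y - 1 + (w.2 - 2) = y + (w.2 - 2) - 1; ring)
  have e4 : ((x - 1 + (w.1 - 4), y + (w.2 - 2)) : Face) = (x + (w.1 - 4) - 1, y + (w.2 - 2)) :=
    Prod.ext (by show x - 1 + (w.1 - 4) = x + (w.1 - 4) - 1; ring) rfl
  refine ⟨by omega, fun h => ?_, fun h => ?_, fun h => ?_, fun h h' => ?_⟩
  · rw [e4] at h ⊢; exact hW h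
  · rw [e2] at h ⊢; exact hN h
  · rw [e3] at h ⊢; exact hS h
  · rw [e1] at h h'
    obtain ⟨ex, ey⟩ := hE h h'
    constructor <;> omega

/-- Transport of the three-way column clause below the kill row to the reference position.
[cite: GlazmanManolescu2019, §4.2 (translation invariance)] -/
private theorem colS_refShift {R : Set Face}
    (hcolS : ∀ y : ℤ, y ≤ w.2 - 3 → (w.1 - 3, y) ∉ dom Dl ∨ (w.1 - 2, y) ∉ dom Dl ∨ ((w.1 - 3, y) : Face) ∈ R) :
    ∀ y : ℤ, y ≤ w42.2 - 3 → (w42.1 - 3, y) ∉ dom (Dl.map (Face.shiftBy (-refShift w))) ∨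
      (w42.1 - 2, y) ∉ dom (Dl.map (Face.shiftBy (-refShift w))) ∨
        ((w42.1 - 3, y) : Face) ∈ {c | Face.shiftBy (refShift w) c ∈ R} := by
  intro y hy
  simp only [w42] at hy ⊢
  rw [show ((4 : ℤ) - 3, y) = ((1 : ℤ), y) by norm_num, show ((4 : ℤ) - 2, y) = ((2 : ℤ), y) by norm_num]
  rcases hcolS (y + (w.2 - 2)) (by omega) with h | h | h
  · left; refine not_mem_refShift 1 y ?_
    have e : ((1 + (w.1 - 4), y + (w.2 - 2)) : Face) = (w.1 - 3, y + (w.2 - 2)) := Prod.ext (by show 1 + (w.1 - 4) = w.1 - 3; ring) rfl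
    rw [e]; exact h
  · right; left; refine not_mem_refShift 2 y ?_
    have e : ((2 + (w.1 - 4), y + (w.2 - 2)) : Face) = (w.1 - 2, y + (w.2 - 2)) := Prod.ext (by show 2 + (w.1 - 4) = w.1 - 2; ring) rfl
    rw [e]; exact h
  · right; right
    simp only [Set.mem_setOf_eq, shiftBy_refShift_mk]
    have e : ((1 + (w.1 - 4), y + (w.2 - 2)) : Face) = (w.1 - 3, y + (w.2 - 2)) := Prod.ext (by show 1 + (w.1 - 4) = w.1 - 3; ring) rfl
    rw [e]; exact h

/-- Transport of the three-way column clause above the kill row to the reference position.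
[cite: GlazmanManolescu2019, §4.2 (translation invariance)] -/
private theorem colN_refShift {R : Set Face}
    (hcolN : ∀ y : ℤ, w.2 + 3 ≤ y → (w.1 - 3, y) ∉ dom Dl ∨ (w.1 - 2, y) ∉ dom Dl ∨ ((w.1 - 3, y) : Face) ∈ R) :
    ∀ y : ℤ, w42.2 + 3 ≤ y → (w42.1 - 3, y) ∉ dom (Dl.map (Face.shiftBy (-refShift w))) ∨
      (w42.1 - 2, y) ∉ dom (Dl.map (Face.shiftBy (-refShift w))) ∨
        ((w42.1 - 3, y) : Face) ∈ {c | Face.shiftBy (refShift w) c ∈ R} := by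
  intro y hy
  simp only [w42] at hy ⊢
  rw [show ((4 : ℤ) - 3, y) = ((1 : ℤ), y) by norm_num, show ((4 : ℤ) - 2, y) = ((2 : ℤ), y) by norm_num]
  rcases hcolN (y + (w.2 - 2)) (by omega) with h | h | h
  · left; refine not_mem_refShift 1 y ?_
    have e : ((1 + (w.1 - 4), y + (w.2 - 2)) : Face) = (w.1 - 3, y + (w.2 - 2)) := Prod.ext (by show 1 + (w.1 - 4) = w.1 - 3; ring) rfl
    rw [e]; exact h
  · right; left; refine not_mem_refShift 2 y ?_
    have e : ((2 + (w.1 - 4), y + (w.2 - 2)) : Face) = (w.1 - 2, y + (w.2 - 2)) := Prod.ext (by show 2 + (w.1 - 4) = w.1 - 2; ring) rfl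
    rw [e]; exact h
  · right; right
    simp only [Set.mem_setOf_eq, shiftBy_refShift_mk]
    have e : ((1 + (w.1 - 4), y + (w.2 - 2)) : Face) = (w.1 - 3, y + (w.2 - 2)) := Prod.ext (by show 1 + (w.1 - 4) = w.1 - 3; ring) rfl
    rw [e]; exact h

/-- The hole at the reference position. [cite: GlazmanManolescu2019, §4.2 (translation invariance)] -/
private theorem hole_refShift (hh : holeFaceW w ∉ dom Dl) :
    holeFaceW w42 ∉ dom (Dl.map (Face.shiftBy (-refShift w))) := by
  rw [mem_dom_map_shiftBy_neg, shiftBy_refShift_holeFaceW]; exact hh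

/-- `K_S2` at the reference position. [cite: GlazmanManolescu2019, §4.2 (translation invariance)] -/
private theorem killSW_refShift (hKS : killSW w ∉ dom Dl) : killSW w42 ∉ dom (Dl.map (Face.shiftBy (-refShift w))) := by
  refine not_mem_refShift 1 0 ?_
  have e : ((1 + (w.1 - 4), 0 + (w.2 - 2)) : Face) = killSW w := Prod.ext (by simp [killSW]; ring) (by simp [killSW])
  rw [e]; exact hKS

/-- `K_N1` at the reference position. [cite: GlazmanManolescu2019, §4.2 (translation invariance)] -/
private theorem killNW_refShift (hKN : killNW w ∉ dom Dl) : killNW w42 ∉ dom (Dl.map (Face.shiftBy (-refShift w))) := by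
  refine not_mem_refShift 1 4 ?_
  have e : ((1 + (w.1 - 4), 4 + (w.2 - 2)) : Face) = killNW w := Prod.ext (by simp [killNW]; ring) (by simp [killNW]; ring)
  rw [e]; exact hKN

/-- ★★★★★ **`K_S2` ALONE ⇒ `Im VF(π/3) > 0`, EVERY POSITION, corridor form** — the master form of the western under-route
kill: hole and `K_S2` absent, a closed western corridor `R` below the kill row, every usable western door of the far
cell's column below the kill row leading into `R`. [cite: GlazmanManolescu2019, Lemma 2.1, §4.2]
[cite: GlazmanManolescu2019, §1 (the paragraph of Fig. 2)] [cite: CourantRobbins1958, Ch. V Appendix §2 (the even–odd rule)] -/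
theorem im_vertexFunctional_printed_pi_div_three_pos_of_killSW_corridor (hB : ∀ c ∈ westBlock w, c ∈ Dl)
    (hh : holeFaceW w ∉ dom Dl) (hKS : killSW w ∉ dom Dl) {R : Set Face} (hR : IsCorridorSW w (dom Dl) R)
    (hcolS : ∀ y : ℤ, y ≤ w.2 - 3 → (w.1 - 3, y) ∉ dom Dl ∨ (w.1 - 2, y) ∉ dom Dl ∨ ((w.1 - 3, y) : Face) ∈ R) :
    0 < (vertexFunctional (printedWeights (π / 3)) tFiveEighths (ybCoeff (π / 3)) Dl (w.side .W) (farW w)).im := by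
  rw [vertexFunctional_printed_eq_refShift Dl w]
  exact im_pos_pi_div_three_of_killSW_block42_corridor (westBlock42_mem_of_westBlock hB) (hole_refShift hh)
    (killSW_refShift hKS) (isCorridorSW_refShift hR) (colS_refShift hcolS)

/-- ★★★★★ **`K_N1` ALONE ⇒ `Im VF(2π/3) < 0`, EVERY POSITION, corridor form.** [cite: GlazmanManolescu2019, Lemma 2.1, §4.2]
[cite: GlazmanManolescu2019, §1, remark after eq. (1)] [cite: CourantRobbins1958, Ch. V Appendix §2 (the even–odd rule)] -/
theorem im_vertexFunctional_printed_two_pi_div_three_neg_of_killNW_corridor (hB : ∀ c ∈ westBlock w, c ∈ Dl)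
    (hh : holeFaceW w ∉ dom Dl) (hKN : killNW w ∉ dom Dl) {R : Set Face} (hR : IsCorridorNW w (dom Dl) R)
    (hcolN : ∀ y : ℤ, w.2 + 3 ≤ y → (w.1 - 3, y) ∉ dom Dl ∨ (w.1 - 2, y) ∉ dom Dl ∨ ((w.1 - 3, y) : Face) ∈ R) :
    (vertexFunctional (printedWeights (2 * π / 3)) tFiveEighths (ybCoeff (2 * π / 3)) Dl (w.side .W) (farW w)).im < 0 := by
  rw [vertexFunctional_printed_eq_refShift Dl w]
  exact im_neg_two_pi_div_three_of_killNW_block42_corridor (westBlock42_mem_of_westBlock hB) (hole_refShift hh)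
    (killNW_refShift hKN) (isCorridorNW_refShift hR) (colN_refShift hcolN)

/-- ★★★★★ **THE WESTERN KILL-FORCED ZERO, EVERY POSITION, corridor form** — the master form of LAW L's west pair: for every
finite face list containing the west witness block `westBlock w`, missing the hole, `K_S2` and `K_N1`, with closed western
corridors taking the usable western doors of the far cell's column below and above the kill rows, the Yang–Baxter vertex
functional at the far cell has an exact zero in `(π/3, 2π/3)`. [cite: GlazmanManolescu2019, Lemma 2.1, §4.2]
[cite: GlazmanManolescu2019, §1 (the paragraph of Fig. 2 and the remark after eq. (1))]
[cite: DuminilCopinSmirnov2012, proof of Lemma 1] [cite: CourantRobbins1958, Ch. V Appendix §2 (the even–odd rule)] -/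
theorem vertexFunctional_printed_farCellW_exists_eq_zero_Ioo_of_west_kills_corridor (Dl : List Face) (w : Face)
    (hB : ∀ c ∈ westBlock w, c ∈ Dl) (hh : holeFaceW w ∉ dom Dl) (hKS : killSW w ∉ dom Dl) (hKN : killNW w ∉ dom Dl)
    {RS RN : Set Face} (hRS : IsCorridorSW w (dom Dl) RS) (hRN : IsCorridorNW w (dom Dl) RN)
    (hcolS : ∀ y : ℤ, y ≤ w.2 - 3 → (w.1 - 3, y) ∉ dom Dl ∨ (w.1 - 2, y) ∉ dom Dl ∨ ((w.1 - 3, y) : Face) ∈ RS)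
    (hcolN : ∀ y : ℤ, w.2 + 3 ≤ y → (w.1 - 3, y) ∉ dom Dl ∨ (w.1 - 2, y) ∉ dom Dl ∨ ((w.1 - 3, y) : Face) ∈ RN) :
    ∃ θ ∈ Set.Ioo (π / 3) (2 * π / 3),
      vertexFunctional (printedWeights θ) tFiveEighths (ybCoeff θ) Dl (w.side .W) (farW w) = 0 := by
  simp_rw [vertexFunctional_printed_eq_refShift Dl w]
  exact exists_eq_zero_of_west_kills_block42_corridor _ (westBlock42_mem_of_westBlock hB) (hole_refShift hh)
    (killSW_refShift hKS) (killNW_refShift hKN) (isCorridorSW_refShift hRS) (isCorridorNW_refShift hRN)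
    (colS_refShift hcolS) (colN_refShift hcolN)

end Translate

/-! ## §7 The corridor row `57b (0,4)` of the corner-kill table, as a closed sign theorem — 44 of 44 -/

section Instances

/-- LAW L frame `57b` = `5×7 ∖ (2, 2)` with the kill cell `(0, 4)` removed alone: beyond it the west wall column
continues as the two-cell corridor `(0,5), (0,6)`. [cite: GlazmanManolescu2019, §2.1 (finite domains of faces)] -/
def frame57b_KN1 : List Face := [(0,0),(0,1),(0,2),(0,3),(0,5),(0,6),(1,0),(1,1),(1,2),(1,3),(1,4),(1,5),(1,6),(2,0),(2,1),(2,3),(2,4),(2,5),(2,6),(3,0),(3,1),(3,2),(3,3),(3,4),(3,5),(3,6),(4,0),(4,1),(4,2),(4,3),(4,4),(4,5),(4,6)]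

/-- The corridor of frame `57b` above the kill cell `(0, 4)`. [cite: GlazmanManolescu2019, §2.1 (finite domains of faces)] -/
def corridor57b_NW : List Face := [(0,5),(0,6)]

/-- The corridor condition of frame `57b` at `(0, 4)`, checked cell by cell (each clause decided on the lists).
[cite: CourantRobbins1958, Ch. V Appendix §2 (the even–odd rule)] -/
theorem isCorridorNW_frame57b : IsCorridorNW (3, 2) (dom frame57b_KN1) (dom corridor57b_NW) := by
  intro c hc
  have hc' : c = (0, 5) ∨ c = (0, 6) := by simpa [dom, corridor57b_NW] using hc
  simp only [dom, Set.mem_setOf_eq]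
  rcases hc' with rfl | rfl
  · exact ⟨by decide, by decide, by decide, by decide, by decide⟩
  · exact ⟨by decide, by decide, by decide, by decide, by decide⟩

/-- ★★ LAW L, frame `57b` (`5×7 ∖ (2, 2)`), cell `(0, 4)` = `K_N1` (over route, `w₁`): the corner-kill table's WEST
corridor row as a closed sign theorem — no local column clause applies (`(0,5)`, `(1,5)`, `(0,6)`, `(1,6)` all present,
no dead end); the corridor clause does. With it all 44 predicted kills of the table are closed theorems.
[cite: GlazmanManolescu2019, Lemma 2.1 (statement, "in the form given in [Gl]")] -/
theorem frame57b_KN1_sign : (vertexFunctional (printedWeights (2 * π / 3)) tFiveEighths (ybCoeff (2 * π / 3)) frame57b_KN1 (Face.side (3, 2) .W) (farW (3, 2))).im < 0 :=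
  im_vertexFunctional_printed_two_pi_div_three_neg_of_killNW_corridor (Dl := frame57b_KN1) (w := (3, 2)) (by decide)
    (show holeFaceW (3, 2) ∉ frame57b_KN1 by decide) (show killNW (3, 2) ∉ frame57b_KN1 by decide)
    (R := dom corridor57b_NW) isCorridorNW_frame57b
    (fun y hy => by
      rcases (show y = 5 ∨ y = 6 ∨ 7 ≤ y by simp only at hy; omega) with rfl | rfl | hy'
      · exact Or.inr (Or.inr (show ((3 : ℤ) - 3, (5 : ℤ)) ∈ corridor57b_NW by decide))
      · exact Or.inr (Or.inr (show ((3 : ℤ) - 3, (6 : ℤ)) ∈ corridor57b_NW by decide))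
      · exact Or.inl (show ((3 : ℤ) - 3, y) ∉ frame57b_KN1 by
          simp only [frame57b_KN1, List.mem_cons, Prod.mk.injEq, List.not_mem_nil, or_false, not_or, not_and]
          omega))

end Instances

end Literature.Barriers.CriticalPhenomena.PlaquetteWalk
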